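import Literature.MathematicalPhysics.QuantumFieldTheory.Balaban1983to89.B9Eq333ProjectionCovariance
import Literature.MathematicalPhysics.QuantumFieldTheory.Balaban1983to89.B9Eq383QSemiLocal
import Literature.MathematicalPhysics.QuantumFieldTheory.Balaban1983to89.B7Prop5GeneralLevels
import Literature.MathematicalPhysics.QuantumFieldTheory.Balaban1983to89.B9Eq349BlockDistanceWeight

/-!
# `Balaban1983to89.B9Eq315QTorusLocality` — T. Bałaban, *Propagators for lattice gauge theories in a background field*, Commun. Math. Phys. **99** (1985)
# 389–434 [Balaban1985BackgroundPropagators] (3.15) p. 393 with [Balaban1985Averaging] (42) p. 23, p. 24 («Ū_c … depends only on the bond variables U_b for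
# b ⊂ B(c₋) ∪ B(c₊)»), (122) p. 36, p. 31: **THE ONE-STEP VECTOR AVERAGING `Q(U)` OF THE TORUS READS THE BACKGROUND ON THE TWO BLOCKS OF THE COARSE
# BOND ONLY** — `(Q(U)A)(y, κ) = (Q(Ũ)A)(y, κ)` as soon as `U = Ũ` on the bonds based in `B(y) ∪ B(y + e_κ)`; hence `Q(U)A = Q(Ũ)A` for a bond field `A`
# supported over a block set `Z₀` when `U = Ũ` over the 1-neighbourhood of `Z₀`, and — with ne9-leaf-03's (3.32) `QtorusW_gaugeU` — the `Q`-transfer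
# letter `‖Q(Ũ)(R(g)A)‖ = ‖Q(U)A‖` of the per-cube gauge reduction: the LAST locality letter of the (3.26) bond form (companion of
# `B9Eq387CubeProjectionLocality` ∕ `B9Eq387CubeProjectionGaugeCovariance`), instance-ledger row L10 (loc) of the pub-balaban NE9 chain

statement-level skeleton of published theorems with citation tags; proofs where landed; nothing here is a claim about the Yang–Mills mass gap

CITATION HEADER (lean-in-tree rule).  Audit cell `pub-balaban`, sub-cell `t4`, BINDER row NE9; filed by NE9 formalisation-swarm LEAF PROVER 05
(`b2b-balaban-t4-ne9-formalise-leaf-05`, gen 78) as a [folklore] COMPOSITION BY NAME of the B7 crew's locality of the linear part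
`B7Prop5GeneralLevels.linQcov_congr` ((122): `L(Q(V₀)A)_c` reads `V₀, A` on `[q, q + (L−1)𝟙 + Le_κ] = B(c₋) ∪ B(c₊)`, `B7Prop1Local.AgreeOn ∕ bondHi`), the
torus dictionary `B9Eq315QTorus.QtorusW_apply ∕ QtorusLin_apply ∕ perCfg ∕ perSite ∕ cornerSite`, the OWNER lineage's `B9Eq383QSemiLocal.
blockCoord_perSite_of_inBox ∕ QtorusLin_congr_local` (the box of a coarse bond read on the torus; semi-locality in the FIELD), and ne9-leaf-03's `B9Eq333ProjectionCovariance.QtorusW_gaugeU` + `B9Eq328GaugeAction.norm_gaugeW`.  CONSUMER BY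
SHAPE: ne9-leaf-06's `B9Eq387CubeReductionSmallField.cube_estimate_of_gauge_reduction` (its displayed `hQ` letter).  Source READ in the held texts: [B9] p. 393
(3.15) «Q(U) = Q(Ū^{k−1}) … Q(U)» (one step); [B7] p. 24, the sentence after (43); (122) p. 36; p. 31 after (91) («the same locality properties»).  NOTHING of
print's estimates is asserted or valued.

WHAT IS PROVED (sorry-free; proof lane — no `def`; [folklore]).
* §1 **`agreeOn_perCfg_of_blocks`** — two torus bond data agreeing on the bonds based in `B(y) ∪ B(y + e_κ)` have periodic extensions that `AgreeOn`
  [B7]'s box `[L·y, L·y + (L−1)𝟙 + Le_κ]` (by the OWNER lineage's `B9Eq383QSemiLocal.blockCoord_perSite_of_inBox`).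
* §2 **`QtorusW_apply_congr`** — `U = Ũ` on the bonds based in `B(y) ∪ B(y + e_κ)` ⇒ `(Q(U)A)(y, κ) = (Q(Ũ)A)(y, κ)` (whatever regularity witnesses the
  two sides carry); **`QtorusW_congr_of_support`** — `A` supported over `Z₀`, `U = Ũ` on every bond whose base block is within coarse distance `1` of
  `Z₀` ⇒ `Q(U)A = Q(Ũ)A` (off `Z₀ ∪ (Z₀ − e_κ)` both sides are `Q(·)0 = 0` by the field semi-locality `B9Eq383QSemiLocal.QtorusLin_congr_local`).
* §3 **`QtorusW_gauge_transfer_of_support`** — with a gauge function `g` (fibrewise isometric `R(g(x))`, `hAd`): `Q(Ũ)(R(g)A) = R(g₁)(Q(U)A)` and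
  **`norm_QtorusW_gauge_transfer`** `‖√a·Q(Ũ)(R(g)A)‖ ≤ ‖√a·Q(U)A‖` (in fact `=`) whenever `U^g = Ũ` over the 1-neighbourhood of the support of `A` —
  ne9-leaf-06's `hQ` letter inhabited.
HONEST SCOPE.  Locality ∕ covariance bookkeeping of ONE averaging step; the regularity witnesses (`α ≤ 1∕64`, `hU1`, `hreg`) of BOTH backgrounds stay
displayed (they define `QtorusW`; the values do not depend on them); no smallness is USED, no window, no estimate.  NOT NE9 (cell pub-balaban: NE9 NOT PRINTED
∕ NOT PROVED; «NE9 ⇐ the named binders»; row WALLED ON A MODEL (O-NE9-1; #5 UNRULED); spine PROVED 0∕9; rung (B)+1 on a finite T⁴ — NOT infinite volume, NOT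
mass gap, NOT Clay; HONEST DEPENDENCY: continuum YM on T⁴ ⇐ BetaPertH ∧ nine spine estimates (0/9 proved); BetaPertH ⇐ (D1) ∧ (D4) ∧ CAP+tail; G-an2-4 gates asym,
D1 and NE2/3/4).  NEW file; nothing modified.  Net new unproved facts: 0.
-/

noncomputable section

set_option autoImplicit false

open scoped InnerProductSpace ComplexConjugate

namespace Literature.MathematicalPhysics.QuantumFieldTheory.Balaban1983to89.B9Eq315QTorusLocality

open B4Sect5Torus (TSite tdist tdist_self tdist_symm)
open B9SectCLatticeCarrier (Bond bpos shift)
open B7Prop1Explicit (boxVec U1 Wcx)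
open B7Prop1Local (AgreeOn InBox bondHi)
open B7Prop3GeneralLinear (linQcov)
open B7Prop5GeneralLevels (linQcov_congr)
open B9Eq311L2Pairing (WL2)
open B11Eq103H1Complex (BondL2K)
open B9Eq319QprimeTorus (fineP centre blockCoord mem_blockOf_iff)
open B9Eq315QTorus (perSite perCfg perCfg_apply cornerSite QtorusLin QtorusLin_apply QtorusW QtorusW_apply)
open B9Eq383QSemiLocal (blockCoord_perSite_of_inBox QtorusLin_congr_local)
open B9Eq328GaugeAction (gaugeU gaugeW AdW equiv_gaugeW norm_gaugeW AdW_inv_apply)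
open B9Eq333ProjectionCovariance (QtorusW_gaugeU)
open B9Eq349BlockDistanceWeight (tdist_shift_le_one)

/-! ## §1 The box `B(c₋) ∪ B(c₊)` of [B7] read on the torus -/

section Box

variable {d : ℕ} (L : ℕ) [NeZero L] (m : Fin d → ℕ) [∀ i, NeZero (fineP L m i)]

omit [NeZero L] in
/-- **Torus bond data agreeing on the bonds based in `B(y) ∪ B(y + e_κ)` have periodic extensions agreeing on [B7]'s box `[L·y, L·y + (L−1)𝟙 + Le_κ]`**
(`B7Prop1Local.AgreeOn`). [cite: Balaban1985Averaging, p.24, (2) p.17] -/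
theorem agreeOn_perCfg_of_blocks {V : Type*} (y : TSite d m) (κ : Fin d) (A A' : Bond d (fineP L m) → V)
    (h : ∀ b : Bond d (fineP L m), (blockCoord L m (bpos b) = y ∨ blockCoord L m (bpos b) = shift κ y) → A b = A' b) :
    AgreeOn (cornerSite L y) (bondHi L (cornerSite L y) κ) (perCfg (fineP L m) A) (perCfg (fineP L m) A') :=
  fun x κ' hx _ => h (perSite (fineP L m) x, κ') (blockCoord_perSite_of_inBox L m y κ x hx)

end Box


/-! ## §2 `Q(U)` reads the background on the two blocks of the coarse bond -/

section Qtorus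

variable {d : ℕ} (L : ℕ) (m : Fin d → ℕ) [∀ i, NeZero (fineP L m i)] (hL : 1 ≤ L)
  {𝔸 : Type*} [NormedRing 𝔸] [NormedAlgebra ℂ 𝔸] [CompleteSpace 𝔸] [NormOneClass 𝔸]
  {W : Type*} [NormedAddCommGroup W] [InnerProductSpace ℂ W] (φ : W ≃ₗ[ℂ] 𝔸) {c₀ c₁ : ℝ}
  (U Ũ : Bond d (fineP L m) → 𝔸ˣ) {α α' : ℝ} (hα1 : α ≤ 1 / 64) (hα1' : α' ≤ 1 / 64)
  (hU1 : ∀ (x : B7Prop1Explicit.Site d) (κ : Fin d), perCfg (fineP L m) U x κ ∈ U1 𝔸)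
  (hreg : ∀ (y : TSite d m) (κ : Fin d) (r : Fin d → Fin L), ‖((Wcx L (perCfg (fineP L m) U) (cornerSite L y) κ (boxVec L r) : 𝔸ˣ) : 𝔸) - 1‖ ≤ α)
  (hU1' : ∀ (x : B7Prop1Explicit.Site d) (κ : Fin d), perCfg (fineP L m) Ũ x κ ∈ U1 𝔸)
  (hreg' : ∀ (y : TSite d m) (κ : Fin d) (r : Fin d → Fin L), ‖((Wcx L (perCfg (fineP L m) Ũ) (cornerSite L y) κ (boxVec L r) : 𝔸ˣ) : 𝔸) - 1‖ ≤ α')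

/-- **`(Q(U)A)(y, κ) = (Q(Ũ)A)(y, κ)` WHEN `U = Ũ` ON THE BONDS BASED IN `B(y) ∪ B(y + e_κ)`** — `QtorusW_apply` ∕ `QtorusLin_apply` reduce both sides to
`L⁻¹·L(Q(·)Ã)_c` at the block corner, and `linQcov_congr` ([B7] p. 24: «depends only on the bond variables … b ⊂ B(c₋) ∪ B(c₊)») does the rest; the
regularity witnesses of the two sides are whatever they are. [cite: Balaban1985BackgroundPropagators, (3.15) p.393; Balaban1985Averaging, p.24, (122) p.36] -/
theorem QtorusW_apply_congr (c : Bond d m)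
    (h : ∀ b : Bond d (fineP L m), (blockCoord L m (bpos b) = c.1 ∨ blockCoord L m (bpos b) = shift c.2 c.1) → U b = Ũ b)
    (A : BondL2K ℂ d (fineP L m) c₀ W) :
    WL2.equiv ℂ (fun _ : Bond d m => c₁) W (QtorusW L m hL φ U hα1 hU1 hreg (c₁ := c₁) A) c =
      WL2.equiv ℂ (fun _ : Bond d m => c₁) W (QtorusW L m hL φ Ũ hα1' hU1' hreg' (c₁ := c₁) A) c := by
  rw [QtorusW_apply, QtorusW_apply, QtorusLin_apply, QtorusLin_apply,
    linQcov_congr L hL (cornerSite L c.1) c.2 (agreeOn_perCfg_of_blocks L m c.1 c.2 U Ũ h) (fun _ _ _ _ => rfl)]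

/-- **`Q(U)A = Q(Ũ)A` FOR `A` SUPPORTED OVER `Z₀` WHEN `U = Ũ` OVER THE 1-NEIGHBOURHOOD OF `Z₀`**: at a coarse bond `(y, κ)` with `y` or `y + e_κ` in `Z₀`
both blocks are within coarse distance `1` of `Z₀` (agreement, previous lemma); otherwise `A` vanishes on `B(y) ∪ B(y + e_κ)` and both sides are
`(Q(·)0)_c = 0` (`QtorusLin_congr_local` in the field slot + `map_zero`). [cite: Balaban1985BackgroundPropagators, (3.15) p.393; Balaban1985Averaging, p.24, (122) p.36] -/
theorem QtorusW_congr_of_support (hm : ∀ i, 1 ≤ m i) (Z₀ : Set (TSite d m))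
    (hUŨ : ∀ b : Bond d (fineP L m), (∃ z ∈ Z₀, tdist m z (blockCoord L m (bpos b)) ≤ 1) → U b = Ũ b)
    (A : BondL2K ℂ d (fineP L m) c₀ W) (hA : ∀ b : Bond d (fineP L m), blockCoord L m (bpos b) ∉ Z₀ → WL2.equiv ℂ _ W A b = 0) :
    QtorusW L m hL φ U hα1 hU1 hreg (c₁ := c₁) A = QtorusW L m hL φ Ũ hα1' hU1' hreg' (c₁ := c₁) A := by
  apply (WL2.equiv ℂ (fun _ : Bond d m => c₁) W).injective
  funext c
  by_cases hc : c.1 ∈ Z₀ ∨ shift c.2 c.1 ∈ Z₀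
  · refine QtorusW_apply_congr L m hL φ U Ũ hα1 hα1' hU1 hreg hU1' hreg' c (fun b hb => hUŨ b ?_) A
    rcases hc with h | h <;> rcases hb with hb | hb
    · exact ⟨_, h, by rw [hb, tdist_self]; norm_num⟩
    · exact ⟨_, h, by rw [hb]; exact tdist_shift_le_one hm _ _⟩
    · exact ⟨_, h, by rw [hb, tdist_symm hm]; exact tdist_shift_le_one hm _ _⟩
    · exact ⟨_, h, by rw [hb, tdist_self]; norm_num⟩
  · rw [not_or] at hc
    -- `A` vanishes on `B(y) ∪ B(y + e_κ)`: both sides are `Q(·)0 = 0` (semi-locality in the field, `QtorusLin_congr_local`)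
    have hA0 : ∀ b : Bond d (fineP L m), (blockCoord L m b.1 = c.1 ∨ blockCoord L m b.1 = shift c.2 c.1) →
        (fun b : Bond d (fineP L m) => φ (WL2.equiv ℂ (fun _ : Bond d (fineP L m) => c₀) W A b)) b =
          (0 : Bond d (fineP L m) → 𝔸) b := fun b hb => by
      rcases hb with hb | hb
      · show φ _ = 0; rw [hA b (by rw [show bpos b = b.1 from rfl, hb]; exact hc.1), map_zero]
      · show φ _ = 0; rw [hA b (by rw [show bpos b = b.1 from rfl, hb]; exact hc.2), map_zero]
    rw [QtorusW_apply, QtorusW_apply, QtorusLin_congr_local L m hL U hα1 hU1 hreg c hA0,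
      QtorusLin_congr_local L m hL Ũ hα1' hU1' hreg' c hA0, map_zero, map_zero]

end Qtorus

/-! ## §3 The `Q`-transfer letter of the per-cube gauge reduction -/

section Transfer

variable {d : ℕ} (L : ℕ) [NeZero L] (m : Fin d → ℕ) [∀ i, NeZero (fineP L m i)] (hL : 1 ≤ L)
  {𝔸 : Type*} [NormedRing 𝔸] [NormedAlgebra ℂ 𝔸] [CompleteSpace 𝔸] [NormOneClass 𝔸]
  {W : Type*} [NormedAddCommGroup W] [InnerProductSpace ℂ W] (φ : W ≃ₗ[ℂ] 𝔸) {c₀ c₁ : ℝ}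
  {g : TSite d (fineP L m) → 𝔸ˣ} (U Ũ : Bond d (fineP L m) → 𝔸ˣ) {α α' : ℝ} (hα1 : α ≤ 1 / 64) (hα1' : α' ≤ 1 / 64)
  (hU1 : ∀ (x : B7Prop1Explicit.Site d) (κ : Fin d), perCfg (fineP L m) U x κ ∈ U1 𝔸)
  (hreg : ∀ (y : TSite d m) (κ : Fin d) (r : Fin d → Fin L), ‖((Wcx L (perCfg (fineP L m) U) (cornerSite L y) κ (boxVec L r) : 𝔸ˣ) : 𝔸) - 1‖ ≤ α)
  (hU1g : ∀ (x : B7Prop1Explicit.Site d) (κ : Fin d), perCfg (fineP L m) (gaugeU g U) x κ ∈ U1 𝔸)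
  (hregg : ∀ (y : TSite d m) (κ : Fin d) (r : Fin d → Fin L),
    ‖((Wcx L (perCfg (fineP L m) (gaugeU g U)) (cornerSite L y) κ (boxVec L r) : 𝔸ˣ) : 𝔸) - 1‖ ≤ α)
  (hU1' : ∀ (x : B7Prop1Explicit.Site d) (κ : Fin d), perCfg (fineP L m) Ũ x κ ∈ U1 𝔸)
  (hreg' : ∀ (y : TSite d m) (κ : Fin d) (r : Fin d → Fin L), ‖((Wcx L (perCfg (fineP L m) Ũ) (cornerSite L y) κ (boxVec L r) : 𝔸ˣ) : 𝔸) - 1‖ ≤ α')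

include hU1g hregg in
/-- **`Q(Ũ)(R(g)A) = R(g₁)(Q(U)A)`, `g₁(y) = g(L·y)` at the coarse base point, WHEN `U^g = Ũ` OVER THE 1-NEIGHBOURHOOD OF THE SUPPORT OF `A`** — locality
(`QtorusW_congr_of_support` at `(U^g, Ũ)`, the support of `R(g)A` being that of `A`) then (3.32) (`QtorusW_gaugeU`). The regularity witnesses of `U^g` are
ne9-leaf-03's `hU1_gaugeU` ∕ `hreg_gaugeU` for `g(x) ∈ U1`; displayed here. [cite: Balaban1985BackgroundPropagators, (3.32) p.396, (3.15) p.393; Balaban1985Averaging, p.24] -/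
theorem QtorusW_gauge_transfer_of_support (hm : ∀ i, 1 ≤ m i) (Z₀ : Set (TSite d m))
    (hgŨ : ∀ b : Bond d (fineP L m), (∃ z ∈ Z₀, tdist m z (blockCoord L m (bpos b)) ≤ 1) → gaugeU g U b = Ũ b)
    (A : BondL2K ℂ d (fineP L m) c₀ W) (hA : ∀ b : Bond d (fineP L m), blockCoord L m (bpos b) ∉ Z₀ → WL2.equiv ℂ _ W A b = 0) :
    QtorusW L m hL φ Ũ hα1' hU1' hreg' (c₁ := c₁) (gaugeW φ (fun b : Bond d (fineP L m) => g (bpos b)) A) =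
      gaugeW φ (fun c : Bond d m => g (centre L m (bpos c))) (QtorusW L m hL φ U hα1 hU1 hreg (c₁ := c₁) A) := by
  have hAg : ∀ b : Bond d (fineP L m), blockCoord L m (bpos b) ∉ Z₀ →
      WL2.equiv ℂ _ W (gaugeW φ (fun b : Bond d (fineP L m) => g (bpos b)) A) b = 0 := fun b hb => by
    rw [equiv_gaugeW, hA b hb, map_zero]
  rw [← QtorusW_congr_of_support L m hL φ (gaugeU g U) Ũ hα1 hα1' hU1g hregg hU1' hreg' hm Z₀ hgŨ _ hAg]
  exact QtorusW_gaugeU L m g U hL φ hα1 hU1 hreg hU1g hregg A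

variable [Fact (0 < c₁)]

include hU1g hregg in
/-- **THE `Q`-TRANSFER LETTER `hQ` OF THE PER-CUBE GAUGE REDUCTION** (`B9Eq387CubeReductionSmallField.cube_estimate_of_gauge_reduction`): for fibrewise isometric
`R(g(x))` (`hAd`), `‖√a·Q(Ũ)(R(g)A)‖ ≤ ‖√a·Q(U)A‖` — an equality in fact (`norm_gaugeW` at the coarse base points). [cite: Balaban1985BackgroundPropagators, (3.30)–(3.32) pp.395–396, (3.15) p.393, Cor 3.6 p.408] -/
theorem norm_QtorusW_gauge_transfer (hm : ∀ i, 1 ≤ m i)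
    (hAd : ∀ (x : TSite d (fineP L m)) (v v' : W), ⟪AdW φ (g x) v, AdW φ (g x) v'⟫_ℂ = ⟪v, v'⟫_ℂ) (Z₀ : Set (TSite d m))
    (hgŨ : ∀ b : Bond d (fineP L m), (∃ z ∈ Z₀, tdist m z (blockCoord L m (bpos b)) ≤ 1) → gaugeU g U b = Ũ b)
    (A : BondL2K ℂ d (fineP L m) c₀ W) (hA : ∀ b : Bond d (fineP L m), blockCoord L m (bpos b) ∉ Z₀ → WL2.equiv ℂ _ W A b = 0) (a : ℝ) :
    ‖((Real.sqrt a : ℝ) : ℂ) • QtorusW L m hL φ Ũ hα1' hU1' hreg' (c₁ := c₁) (gaugeW φ (fun b : Bond d (fineP L m) => g (bpos b)) A)‖ ≤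
      ‖((Real.sqrt a : ℝ) : ℂ) • QtorusW L m hL φ U hα1 hU1 hreg (c₁ := c₁) A‖ := by
  rw [QtorusW_gauge_transfer_of_support L m hL φ U Ũ hα1 hα1' hU1 hreg hU1g hregg hU1' hreg' hm Z₀ hgŨ A hA, norm_smul, norm_smul,
    norm_gaugeW φ (fun c : Bond d m => g (centre L m (bpos c))) (fun c : Bond d m => hAd (centre L m (bpos c)))]

end Transfer

end Literature.MathematicalPhysics.QuantumFieldTheory.Balaban1983to89.B9Eq315QTorusLocality

end
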